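import Literature.Algebra.Polynomial.SturmTheorem
import HarnessLib

/-!
# Descartes' rule of signs for polynomial systems supported on circuits (Bihan–Dickenstein 2017)

F. Bihan, A. Dickenstein, *Descartes' rule of signs for polynomial systems supported on circuits*,
Int. Math. Res. Not. IMRN 2017 (22) 6867–6893 = arXiv:1601.05826 [BihanDickenstein2017]. Typed
STATEMENTS (definitions with bodies, theorems as cite-tagged named facts `def … : Prop`, D-0014) of
§1–§3 and §5 of the paper, in the PRINTED numbering (arXiv v3 = the accepted revision, one counter
`\numberwithin{thm}{section}`; the journal typeset is not held — numbering expected identical, not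
verified); store locators `pNNNN:Lnn` refer to the held text `paper:arxiv-1601.05826` (flat numbers
"Theorem 9" = Thm 2.9 etc., concordance `pub/val-lit/lit/CONCORDANCE-printed.md § BD17`). Typed for
the cell `val-lit` (row X4-BD17) as a SOURCE for LADDER-VALIANT V1 ideation (sign-variation bounds
for real zeros); no val-lit fact depends on it. Honest framing: typed ≠ proved; nothing here bears
on VP versus VNP.

Setting (§1, p0002–p0003): an exponent set `𝒜 = {w_0, …, w_{n+1}} ⊂ ℤ^n` of cardinality `n + 2`, a
real coefficient matrix `C ∈ ℝ^{n × (n+2)}`, the system `f_i(x) = ∑_j c_{ij} x^{w_j} = 0`,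
`i = 1, …, n` (1.1), and `n_𝒜(C)` = the number of its solutions in `ℝ^n_{>0}` counted with
multiplicity; the matrix `A ∈ ℤ^{(n+1) × (n+2)}` with a first row of ones above the columns `w_j`
(1.2); the standing hypotheses `rk A = n + 1`, `rk C = n` (1.3) and `0 ∈ 𝒞° = ℝ_{>0}C_0 + ⋯ +
ℝ_{>0}C_{n+1}` (1.5) ("this condition means that there is a positive vector in the kernel of the
coefficient matrix", p0006:L1); and from §2.1 on the standing assumption that `𝒜` is a circuit
("to simplify the notation, we will assume in what follows that `m = n`, that is, that `𝒜` is a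
circuit", p0005:L60) — every typed theorem below carries `IsCircuit` explicitly.

## Coverage (source item → declaration → status)

* (1.1), `n_𝒜(C)` → `BD17.monomial`, `BD17.systemEval`, `BD17.posSolutions`; the count WITH
  multiplicity → `BD17.solMultiplicity` (the algebraic local multiplicity `dim_ℝ ℝ[x]_{𝔪_x}/(f)`, on
  the system cleared of negative exponents), `BD17.numPosSols` (`∑ᶠ` over the positive solutions;
  "`n_𝒜(C)` finite" is typed as `(posSolutions w C).Finite`, see the docstring); (1.2) →
  `BD17.expMatrix`; (1.3) → `BD17.RankCond`; (1.5) → `BD17.PosConeCond`.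
* §2.1: `λ_ℓ = (−1)^{ℓ+1} det A(ℓ)` (p0004:L33) → `BD17.affRel`; index `I`, `λ̃` (2.2) →
  `BD17.relIndex`, `BD17.affRelCoprime`; `vol_{ℤ𝒜}(𝒜)` (2.3)–(2.4) → `BD17.normVolume` (typed through
  the printed identity `vol_{ℤ𝒜}(𝒜) = ∑_{λ_i > 0} λ̃_i`, p0005:L24; the Euclidean-volume definition is
  not typed); circuit (p0005:L27) → `BD17.IsCircuit`; Def. 2.1 signature `{a₊, a₋}`, `σ(𝒜)` →
  `BD17.sigPos`, `BD17.sigNeg`, `BD17.sigma`.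
* §2.2: `C(i,j)` (p0006:L6) → `BD17.coeffMinor` (with "we will understand that
  `det C(ᾱ_i, ᾱ_i) = 0`", p0011:L7); Lemma 2.2 / 2.3 (easy Gale facts) not typed; Gale dual
  (p0006:L44) → `BD17.IsGaleDual`, `det(P_i, P_j)` → `BD17.galeDet`; Def. 2.5 ordering →
  `BD17.IsOrdering`; Prop. 2.6 → `BD2017_prop_2_6` FACT; Prop. 2.7 → `BD2017_prop_2_7` FACT;
  uniform `C` (p0004:L6, p0007:L33) → `BD17.IsUniform`.
* §2.3: maximal `K` (p0007:L9) → `BD17.MinorsNonzeroOn`, `BD17.IsMaxMinorSet`; `ᾱ : [k] → K` →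
  `BD17.restrictOrdering`; `K_j` (2.12) → `BD17.minorClass`; `λ̄_j` (2.13) → `BD17.lambdaBar`;
  `s_α` (2.14) → `BD17.sAlpha` (a `List ℝ`; `sgnvar` = the tree's `Literature.Algebra.Polynomial.signVar`,
  CITED, not restated); **Thm. 2.9** → `BD2017_thm_2_9` FACT; Examples 2.10/2.11 not typed;
  **Prop. 2.12** → `BD2017_prop_2_12` FACT (its "in particular" clauses not typed separately);
  **Prop. 2.13** → `BD2017_prop_2_13` FACT.
* §3: **Cor. 3.1** → `BD2017_cor_3_1` FACT; Rem. 3.2 not typed; **Thm. 3.3** → `BD2017_thm_3_3` FACT;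
  **Cor. 3.4** → `BD2017_cor_3_4` FACT.
* §4 (proof of Thm. 2.9; Def. 4.1, Prop. 4.2 = Pólya–Szegő, Prop. 4.3, Lemma 4.4): not in this file.
* §5: **Thm. 5.1** (optimality) → `BD2017_thm_5_1` FACT; Examples 5.2/5.3 not typed.

Design notes. Exponents are integer vectors and solutions are positive, so `x^{w} = ∏_k x_k^{w_k}`
is an integer power (`zpow`). Indices `[n+2] = {0, …, n+1}` are `Fin (n + 2)` (the paper is
`0`-based, p0004:L21), so the printed signs `(−1)^{ℓ+1}`, `(−1)^{α_i+α_j}` are literal. The count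
`numPosSols` returns the junk value `0` when the positive solution set is infinite (print: `∞`);
accordingly "`n_𝒜(C)` is finite" / "`n_𝒜(C) < ∞`" is ALWAYS rendered by the hypothesis
`(posSolutions w C).Finite`, and "`n_𝒜(C) > 0`" by `(posSolutions w C).Nonempty`.

## Faithfulness sheet (typed vs printed, per declaration)

* Definitions `monomial` … `sAlpha`, `realPt`: FAITHFUL renderings of (1.1)–(1.5), (2.1)–(2.6),
  Def. 2.1, `C(i,j)`, Gale duals, Def. 2.5, `K`, `ᾱ`, (2.12)–(2.14), with two INTERPRETATIONS
  stated in their docstrings: `solMultiplicity`/`numPosSols` (the print says "counted with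
  multiplicity" without a definition; we use the standard local intersection multiplicity) and
  `normVolume` (typed by the printed identity (2.4), not by Euclidean volume).
* `BD2017_prop_2_6`, `BD2017_prop_2_7`: FAITHFUL ("full rank" = `rk C = n`).
* `BD2017_thm_2_9`, `BD2017_prop_2_13`, `BD2017_cor_3_1`, `BD2017_thm_3_3`, `BD2017_cor_3_4`:
  FAITHFUL, with the standing assumption "`𝒜` is a circuit" (§2.1) and the finiteness of `n_𝒜(C)`
  made explicit hypotheses (WEAKER only insofar as the print's sentence "if `𝒜` is not a circuit,
  `n` has to be replaced by `m`" is not typed).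
* `BD2017_prop_2_12`: FAITHFUL for its two displayed sentences; the "In particular" paragraph (no
  Cayley structure / `C` uniform) is NOT typed.
* `BD2017_thm_5_1`: FAITHFUL; in (2) the dimension `n` is existential (the print's "for any positive
  integers `a₊, a₋` there exist `A, C ∈ ℝ^{n×(n+2)}`" forces `n + 2 = a₊ + a₋`).
* `affRel_example_2_10`, `signature_example_2_10`: PROVED sanity checks (Ex. 2.10's sign pattern).
* NOT-IN-PRINT: nothing is asserted beyond the source; §4 (Def. 4.1, Prop. 4.2–4.3, Lemma 4.4) and
  the Examples/Remarks are deliberately not typed here.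

## References

* [BihanDickenstein2017] F. Bihan, A. Dickenstein, *Descartes' rule of signs for polynomial
  systems supported on circuits*, IMRN 2017 (22) 6867–6893; arXiv:1601.05826.
* [BasuPollackRoy2006] S. Basu, R. Pollack, M.-F. Roy, *Algorithms in Real Algebraic Geometry*,
  Notation 2.32 (the sign variation `Var`, the tree's `signVar`).
* G. Pólya, G. Szegő, *Problems and theorems in analysis II*, Part V §87–90 (Prop. 4.2 of the
  paper; not typed here).
-/

noncomputable section

open Matrix Finset
open Literature.Algebra.Polynomial (signVar)

namespace Literature.Computability.AlgebraicComplexity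

namespace BD17

variable {n : ℕ}

/-! ### §1 The system, its positive solutions and their number -/

/-- The monomial `x^v = ∏_k x_k^{v_k}` of an integer exponent vector `v ∈ ℤ^n` at `x ∈ ℝ^n` (used
for `x ∈ ℝ^n_{>0}`; integer powers). [cite: BihanDickenstein2017, §1 eq. (1.1)] -/
def monomial (v : Fin n → ℤ) (x : Fin n → ℝ) : ℝ :=
  ∏ k, x k ^ v k

/-- `f_i(x) = ∑_{j=0}^{n+1} c_{i,j} x^{w_j}`, the `i`-th polynomial of the system (1.1) with support
`𝒜 = {w_0, …, w_{n+1}}` and coefficient matrix `C`. [cite: BihanDickenstein2017, §1 eq. (1.1)] -/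
def systemEval (w : Fin (n + 2) → Fin n → ℤ) (C : Matrix (Fin n) (Fin (n + 2)) ℝ)
    (x : Fin n → ℝ) (i : Fin n) : ℝ :=
  ∑ j, C i j * monomial (w j) x

/-- The set of real positive solutions `x ∈ ℝ^n_{>0}` of the system (1.1).
[cite: BihanDickenstein2017, §1 eq. (1.1)] -/
def posSolutions (w : Fin (n + 2) → Fin n → ℤ) (C : Matrix (Fin n) (Fin (n + 2)) ℝ) :
    Set (Fin n → ℝ) :=
  {x | (∀ k, 0 < x k) ∧ ∀ i, systemEval w C x i = 0}

/-- The coordinatewise minimum `min_j w_{j,k}` of the exponents (plumbing: used to clear negative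
exponents; multiplying an equation by a monomial does not change its positive zeros nor their
multiplicities, cf. "the number of positive solutions is unaltered if we multiply each equation by a
fixed monomial", p0003:L3). [cite: BihanDickenstein2017, §1 (after eq. (1.1))] -/
def expShift (w : Fin (n + 2) → Fin n → ℤ) (k : Fin n) : ℤ :=
  Finset.univ.inf' ⟨0, Finset.mem_univ _⟩ fun j => w j k

/-- The `i`-th equation as an honest polynomial: `x^{-min} f_i = ∑_j c_{i,j} ∏_k X_k^{w_{j,k} − min_k}`.
[cite: BihanDickenstein2017, §1 (after eq. (1.1))] -/
def shiftedPoly (w : Fin (n + 2) → Fin n → ℤ) (C : Matrix (Fin n) (Fin (n + 2)) ℝ) (i : Fin n) :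
    MvPolynomial (Fin n) ℝ :=
  ∑ j, MvPolynomial.C (C i j) * ∏ k, MvPolynomial.X k ^ (w j k - expShift w k).toNat

/-- The ideal `(f_1, …, f_n) ⊆ ℝ[x_1, …, x_n]` of the (monomially cleared) system.
[cite: BihanDickenstein2017, §1 eq. (1.1)] -/
def systemIdeal (w : Fin (n + 2) → Fin n → ℤ) (C : Matrix (Fin n) (Fin (n + 2)) ℝ) :
    Ideal (MvPolynomial (Fin n) ℝ) :=
  Ideal.span (Set.range (shiftedPoly w C))

/-- The maximal ideal `𝔪_x = {F | F(x) = 0}` of a point `x ∈ ℝ^n`. [folklore] -/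
def pointIdeal (x : Fin n → ℝ) : Ideal (MvPolynomial (Fin n) ℝ) :=
  RingHom.ker (MvPolynomial.eval x)

/-- The **multiplicity** of a point `x` as a solution of the system (1.1): the intersection
multiplicity `dim_ℝ ℝ[x_1,…,x_n]_{𝔪_x} / (f_1, …, f_n)` of the local algebra (junk `0` if `x` is
not an isolated solution over `ℂ`, the local algebra being infinite-dimensional; `0` if `x` is not a
solution). The paper counts positive solutions "with multiplicity" (p0003:L1) and identifies the
multiplicity with that of the corresponding root of a univariate function under Gale duality
([BS08], p0011:L63). [cite: BihanDickenstein2017, §1 (after eq. (1.1))] -/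
def solMultiplicity (w : Fin (n + 2) → Fin n → ℤ) (C : Matrix (Fin n) (Fin (n + 2)) ℝ)
    (x : Fin n → ℝ) : ℕ :=
  haveI : (pointIdeal x).IsMaximal :=
    RingHom.ker_isMaximal_of_surjective (MvPolynomial.eval x) fun a =>
      ⟨MvPolynomial.C a, MvPolynomial.eval_C a⟩
  Module.finrank ℝ
    (Localization.AtPrime (pointIdeal x) ⧸
      (systemIdeal w C).map
        (algebraMap (MvPolynomial (Fin n) ℝ) (Localization.AtPrime (pointIdeal x))))

/-- **`n_𝒜(C)`**, "the number of real positive solutions of (1.1) counted with multiplicity"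
(p0003:L1): the sum of the multiplicities over the positive solutions — with the junk value `0`
when the positive solution set is infinite (print: `n_𝒜(C) = ∞`); the printed hypothesis
"`n_𝒜(C)` is finite" is therefore always typed as `(posSolutions w C).Finite` (equivalent: a finite
set of positive solutions has finite total multiplicity, p0011:L68–72).
[cite: BihanDickenstein2017, §1 (after eq. (1.1))] -/
def numPosSols (w : Fin (n + 2) → Fin n → ℤ) (C : Matrix (Fin n) (Fin (n + 2)) ℝ) : ℕ :=
  ∑ᶠ x ∈ posSolutions w C, solMultiplicity w C x

/-- The integer matrix `A ∈ ℤ^{(n+1) × (n+2)}` (1.2): a first row of ones above the columns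
`w_0, …, w_{n+1}`. [cite: BihanDickenstein2017, §1 eq. (1.2)] -/
def expMatrix (w : Fin (n + 2) → Fin n → ℤ) : Matrix (Fin (n + 1)) (Fin (n + 2)) ℤ :=
  Matrix.of fun i j => (Fin.cons 1 (w j) : Fin (n + 1) → ℤ) i

/-- The standing rank hypotheses (1.3): `rk A = n + 1` and `rk C = n`.
[cite: BihanDickenstein2017, §1 eq. (1.3)] -/
def RankCond (w : Fin (n + 2) → Fin n → ℤ) (C : Matrix (Fin n) (Fin (n + 2)) ℝ) : Prop :=
  ((expMatrix w).map (Int.cast : ℤ → ℝ)).rank = n + 1 ∧ C.rank = n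

/-- The necessary condition (1.5) `0 ∈ 𝒞° = ℝ_{>0}C_0 + ⋯ + ℝ_{>0}C_{n+1}`: "there is a positive
vector in the kernel of the coefficient matrix" (p0006:L1). [cite: BihanDickenstein2017, §1 eq. (1.5)] -/
def PosConeCond (C : Matrix (Fin n) (Fin (n + 2)) ℝ) : Prop :=
  ∃ u : Fin (n + 2) → ℝ, (∀ j, 0 < u j) ∧ C.mulVec u = 0

/-! ### §2.1 The configuration `𝒜` and the matrix `A` -/

/-- `λ_ℓ = (−1)^{ℓ+1} det A(ℓ)` (`ℓ ∈ [n+2] = {0, …, n+1}`), `A(ℓ)` = `A` with the column `ℓ` removed;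
the vector `λ` generates `ker A` and gives an affine relation `∑ λ_ℓ w_ℓ = 0`, `∑ λ_ℓ = 0` (2.1).
[cite: BihanDickenstein2017, §2.1 eq. (2.1)] -/
def affRel (w : Fin (n + 2) → Fin n → ℤ) (ℓ : Fin (n + 2)) : ℤ :=
  (-1) ^ (ℓ.val + 1) * ((expMatrix w).submatrix id ℓ.succAbove).det

/-- The index `I = gcd(λ_0, …, λ_{n+1}) ∈ ℤ_{≥ 0}` of `ℤ𝒜` in `ℤ^n` (2.2) (the normalised, i.e.
nonnegative, gcd). [cite: BihanDickenstein2017, §2.1 eq. (2.2)] -/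
def relIndex (w : Fin (n + 2) → Fin n → ℤ) : ℤ :=
  Finset.univ.gcd (affRel w)

/-- `λ̃_ℓ = λ_ℓ / I` (2.2), the coprime affine relation. [cite: BihanDickenstein2017, §2.1 eq. (2.2)] -/
def affRelCoprime (w : Fin (n + 2) → Fin n → ℤ) (ℓ : Fin (n + 2)) : ℤ :=
  affRel w ℓ / relIndex w

/-- The normalised volume `vol_{ℤ𝒜}(𝒜) = vol_ℤ(𝒜)/I` (2.3), typed through the printed identity
`vol_{ℤ𝒜}(𝒜) = ∑_{λ_i > 0} λ̃_i = −∑_{λ_i < 0} λ̃_i` (2.4) (the Euclidean-volume definition is not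
typed). [cite: BihanDickenstein2017, §2.1 eq. (2.3)–(2.4)] -/
def normVolume (w : Fin (n + 2) → Fin n → ℤ) : ℤ :=
  ∑ ℓ ∈ Finset.univ.filter (fun ℓ => 0 < affRel w ℓ), affRelCoprime w ℓ

/-- "`𝒜` is said to be a circuit if `λ_j ≠ 0` for all `j`" (p0005:L27), equivalently any `n + 1` of
its points are affinely independent. [cite: BihanDickenstein2017, §2.1] -/
def IsCircuit (w : Fin (n + 2) → Fin n → ℤ) : Prop :=
  ∀ ℓ, affRel w ℓ ≠ 0

/-- `a₊ = |ℵ₊|`, `ℵ₊ = {j ∈ [n+2] : λ_j > 0}` (Def. 2.1). [cite: BihanDickenstein2017, Def. 2.1] -/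
def sigPos (w : Fin (n + 2) → Fin n → ℤ) : ℕ :=
  (Finset.univ.filter fun ℓ => 0 < affRel w ℓ).card

/-- `a₋ = |ℵ₋|`, `ℵ₋ = {j ∈ [n+2] : λ_j < 0}` (Def. 2.1). [cite: BihanDickenstein2017, Def. 2.1] -/
def sigNeg (w : Fin (n + 2) → Fin n → ℤ) : ℕ :=
  (Finset.univ.filter fun ℓ => affRel w ℓ < 0).card

/-- **Def. 2.1**: the signature of the circuit `𝒜` is the unordered pair `{a₊, a₋}`, and
`σ(𝒜) = min{a₊, a₋}` (2.6). [cite: BihanDickenstein2017, Def. 2.1] -/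
def sigma (w : Fin (n + 2) → Fin n → ℤ) : ℕ :=
  min (sigPos w) (sigNeg w)

/-! ### §2.2 The matrix `C`: minors, Gale duals, orderings -/

/-- `det C(i,j)`, where `C(i,j)` is "the submatrix of `C` with columns indexed by `[n+2] ∖ {i,j}`
(in the same order)" (p0006:L6; `i ≠ j` in either order), with the convention
`det C(i,i) := 0` ("We will understand that `det(C(ᾱ_i, ᾱ_i)) = 0`", p0011:L7). These are the
maximal minors of `C`. [cite: BihanDickenstein2017, §2.2] -/
def coeffMinor (C : Matrix (Fin n) (Fin (n + 2)) ℝ) (i j : Fin (n + 2)) : ℝ :=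
  if h : i = j then 0
  else (C.submatrix id fun t => (Finset.univ \ ({i, j} : Finset (Fin (n + 2)))).orderEmbOfFin
    (by rw [Finset.card_sdiff_of_subset (Finset.subset_univ _), Finset.card_univ, Fintype.card_fin,
          Finset.card_pair h, Nat.add_sub_cancel]) t).det

/-- "`C` is uniform", "that is, with all nonzero [maximal] minors" (p0004:L6; "`C` is uniform" iff
"all maximal minors of `C` are nonzero", p0007:L33). [cite: BihanDickenstein2017, §2.3] -/
def IsUniform (C : Matrix (Fin n) (Fin (n + 2)) ℝ) : Prop :=
  ∀ i j : Fin (n + 2), i ≠ j → coeffMinor C i j ≠ 0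

/-- `B ∈ ℝ^{(n+2) × 2}` is a **Gale dual** matrix of `C`: "a matrix whose columns generate `Ker(C)`";
its rows `P_0, …, P_{n+1} ∈ ℝ²` are the Gale dual configuration (p0006:L44–48).
[cite: BihanDickenstein2017, §2.2 (before Lemma 2.3)] -/
def IsGaleDual (C : Matrix (Fin n) (Fin (n + 2)) ℝ) (B : Matrix (Fin (n + 2)) (Fin 2) ℝ) : Prop :=
  Submodule.span ℝ (Set.range fun t : Fin 2 => fun j : Fin (n + 2) => B j t) =
    LinearMap.ker (Matrix.mulVecLin C)

/-- `det(P_i, P_j)` for the rows `P_i = (B_{i,1}, B_{i,2})` of a Gale dual matrix.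
[cite: BihanDickenstein2017, Def. 2.5] -/
def galeDet (B : Matrix (Fin (n + 2)) (Fin 2) ℝ) (i j : Fin (n + 2)) : ℝ :=
  B i 0 * B j 1 - B i 1 * B j 0

/-- **Def. 2.5**: an ordering of `C` is a bijection `α : [n+2] → [n+2]` such that for any choice of
Gale dual vectors `P_0, …, P_{n+1}` there exists `ε ∈ {1, −1}` with `ε det(P_{α_i}, P_{α_j}) ≥ 0`
for any `i < j`. [cite: BihanDickenstein2017, Def. 2.5] -/
def IsOrdering (C : Matrix (Fin n) (Fin (n + 2)) ℝ) (α : Equiv.Perm (Fin (n + 2))) : Prop :=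
  ∀ B : Matrix (Fin (n + 2)) (Fin 2) ℝ, IsGaleDual C B →
    ∃ ε : ℝ, (ε = 1 ∨ ε = -1) ∧ ∀ i j : Fin (n + 2), i < j → 0 ≤ ε * galeDet B (α i) (α j)

/-! ### §2.3 The data `K`, `ᾱ`, `K_j`, `λ̄_j`, `s_α` of the main theorem -/

/-- "`det(C(i,j)) ≠ 0` for any distinct `i, j ∈ K`" (p0007:L9). [cite: BihanDickenstein2017, §2.3] -/
def MinorsNonzeroOn (C : Matrix (Fin n) (Fin (n + 2)) ℝ) (K : Finset (Fin (n + 2))) : Prop :=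
  ∀ i ∈ K, ∀ j ∈ K, i ≠ j → coeffMinor C i j ≠ 0

/-- `K ⊂ [n+2]` "maximal (under containment) such that `det(C(i,j)) ≠ 0` for any distinct
`i, j ∈ K`" (p0007:L8–10; `k = |K| ≥ 2`). [cite: BihanDickenstein2017, §2.3] -/
def IsMaxMinorSet (C : Matrix (Fin n) (Fin (n + 2)) ℝ) (K : Finset (Fin (n + 2))) : Prop :=
  MinorsNonzeroOn C K ∧ ∀ K' : Finset (Fin (n + 2)), K ⊂ K' → ¬ MinorsNonzeroOn C K'

/-- `ᾱ : [k] → K`, "the bijection which is deduced from `α`" (p0007:L11): the elements of `K` listed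
in the order in which they occur in the sequence `α_0, α_1, …, α_{n+1}` (the positions `t` with
`α_t ∈ K`, increasingly, are `K.map α⁻¹` enumerated by `orderEmbOfFin`).
[cite: BihanDickenstein2017, §2.3] -/
def restrictOrdering (α : Equiv.Perm (Fin (n + 2))) (K : Finset (Fin (n + 2))) :
    Fin K.card → Fin (n + 2) :=
  fun t => α ((K.map α.symm.toEmbedding).orderEmbOfFin (Finset.card_map _) t)

/-- `K_j = {ℓ ∈ [n+2] : ℓ = ᾱ_j or det(C(ᾱ_j, ℓ)) = 0}` (2.12), `j ∈ [k]`; these sets partition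
`[n+2]`. [cite: BihanDickenstein2017, §2.3 eq. (2.12)] -/
def minorClass (C : Matrix (Fin n) (Fin (n + 2)) ℝ) (K : Finset (Fin (n + 2)))
    (α : Equiv.Perm (Fin (n + 2))) (j : Fin K.card) : Finset (Fin (n + 2)) :=
  Finset.univ.filter fun ℓ => ℓ = restrictOrdering α K j ∨ coeffMinor C (restrictOrdering α K j) ℓ = 0

/-- The linear forms `λ̄_j = ∑_{ℓ ∈ K_j} λ_ℓ = ∑_{ℓ ∈ K_j} (−1)^{ℓ+1} det A(ℓ)` (2.13), `j ∈ [k]`.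
[cite: BihanDickenstein2017, §2.3 eq. (2.13)] -/
def lambdaBar (w : Fin (n + 2) → Fin n → ℤ) (C : Matrix (Fin n) (Fin (n + 2)) ℝ)
    (K : Finset (Fin (n + 2))) (α : Equiv.Perm (Fin (n + 2))) (j : Fin K.card) : ℤ :=
  ∑ ℓ ∈ minorClass C K α j, affRel w ℓ

/-- The ordered sequence `s_α = (λ̄_0, …, λ̄_{k−1})` (2.14) (as a list of reals, for the tree's
sign variation `signVar` = the paper's `sgnvar`, p0001:L17). [cite: BihanDickenstein2017, §2.3 eq. (2.14)] -/
def sAlpha (w : Fin (n + 2) → Fin n → ℤ) (C : Matrix (Fin n) (Fin (n + 2)) ℝ)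
    (K : Finset (Fin (n + 2))) (α : Equiv.Perm (Fin (n + 2))) : List ℝ :=
  List.ofFn fun j : Fin K.card => (lambdaBar w C K α j : ℝ)

/-- The points of `𝒜` as real vectors (for the convex-geometric hypothesis of Cor. 3.4).
[cite: BihanDickenstein2017, §1] -/
def realPt (w : Fin (n + 2) → Fin n → ℤ) (j : Fin (n + 2)) : Fin n → ℝ :=
  fun k => (w j k : ℝ)

/-- **Example 2.10, the data** (`n = 1`, a trinomial `c_0 x^{w_0} + c_1 x^{w_1} + c_2 x^{w_2}`,
`w_0 < w_1 < w_2`): "the coefficients `λ_0` and `λ_2` have the same sign, which is opposite to that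
of `λ_1`" — for the exponents `0 < 1 < 2`, `λ = (−1, 2, −1)` (sanity check of the sign convention
`λ_ℓ = (−1)^{ℓ+1} det A(ℓ)`). [cite: BihanDickenstein2017, Ex. 2.10] -/
theorem affRel_example_2_10 : affRel (n := 1) ![![0], ![1], ![2]] = ![-1, 2, -1] := by
  funext ℓ
  fin_cases ℓ <;>
    simp [affRel, expMatrix, Matrix.det_fin_two, Fin.succAbove, Matrix.submatrix, Fin.cons_one,
      Fin.cons_zero, Matrix.of_apply]

/-- **Example 2.10, the signature**: the trinomial circuit `{0, 1, 2} ⊂ ℤ` has `a₊ = 1`, `a₋ = 2`,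
`σ = 1` (so Thm. 3.3 gives the classical bound `2` for trinomials). [cite: BihanDickenstein2017, Ex. 2.10] -/
theorem signature_example_2_10 :
    sigPos (n := 1) ![![0], ![1], ![2]] = 1 ∧ sigNeg (n := 1) ![![0], ![1], ![2]] = 2 ∧
      sigma (n := 1) ![![0], ![1], ![2]] = 1 := by
  simp only [sigma, sigPos, sigNeg, affRel_example_2_10]
  decide

end BD17

open BD17

/-! ### §2 Statements (named facts) -/

section Facts

/-- **BD 2017, Prop. 2.6** (p0006:L72 "Proposition 6"): "Let `C ∈ ℝ^{n×(n+2)}` be a full rank matrix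
satisfying (1.5). Then, there exists an ordering `α` of `C`." [cite: BihanDickenstein2017, Prop. 2.6] -/
def BD2017_prop_2_6 : Prop :=
  ∀ (n : ℕ) (C : Matrix (Fin n) (Fin (n + 2)) ℝ), C.rank = n → PosConeCond C →
    ∃ α : Equiv.Perm (Fin (n + 2)), IsOrdering C α

/-- **BD 2017, Prop. 2.7** (p0006:L124 "Proposition 7"): "Let `C ∈ ℝ^{n×(n+2)}` be a full rank matrix
satisfying (1.5). A bijection `α : [n+2] → [n+2]` is an ordering for `C` if and only if there exists
`ε ∈ {1, −1}` such that `ε (−1)^{α_i+α_j} det(C(α_i, α_j)) (α_j − α_i)/(j − i) ≥ 0` for any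
distinct `i, j ∈ [n+2]`." [cite: BihanDickenstein2017, Prop. 2.7] -/
def BD2017_prop_2_7 : Prop :=
  ∀ (n : ℕ) (C : Matrix (Fin n) (Fin (n + 2)) ℝ), C.rank = n → PosConeCond C →
    ∀ α : Equiv.Perm (Fin (n + 2)),
      IsOrdering C α ↔ ∃ ε : ℝ, (ε = 1 ∨ ε = -1) ∧ ∀ i j : Fin (n + 2), i ≠ j →
        0 ≤ ε * (-1) ^ ((α i).val + (α j).val) * coeffMinor C (α i) (α j) *
          ((((α j).val : ℝ) - (α i).val) / ((j.val : ℝ) - i.val))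

/-- **BD 2017, Thm. 2.9 (main theorem)** (p0007:L52 "Theorem 9"): "Let `𝒜 = {w_0, …, w_{n+1}} ⊂ ℤ^n`,
`A ∈ ℤ^{(n+1)×(n+2)}` and `C ∈ ℝ^{n×(n+2)}` satisfying (1.3) and (1.5). Let `α` be an ordering
for `C`, and let `K`, `|K| = k ≤ n + 2`, and the linear forms `λ̄_j`, `j ∈ [k]`, be as above. Then, if
`n_A(C)` is finite, `n_A(C) ≤ sgnvar(s_α)` (2.15) … Moreover,
`n_A(C) ≤ min{sgnvar(s_α), vol_{ℤ𝒜}(𝒜)}` (2.16)." (`𝒜` a circuit: standing assumption of §2.1.)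
[cite: BihanDickenstein2017, Thm. 2.9] -/
def BD2017_thm_2_9 : Prop :=
  ∀ (n : ℕ) (w : Fin (n + 2) → Fin n → ℤ) (C : Matrix (Fin n) (Fin (n + 2)) ℝ),
    RankCond w C → PosConeCond C → IsCircuit w →
    ∀ α : Equiv.Perm (Fin (n + 2)), IsOrdering C α →
    ∀ K : Finset (Fin (n + 2)), IsMaxMinorSet C K →
      (posSolutions w C).Finite →
        numPosSols w C ≤ signVar (sAlpha w C K α) ∧ (numPosSols w C : ℤ) ≤ normVolume w

/-- **BD 2017, Prop. 2.12** (p0008:L13 "Proposition 12"): "With our previous assumptions about `A` and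
`C` and our previous notations, assume moreover that both `λ̄_0`, `λ̄_{k−1}` are different from `0`.
Then, the difference `sgnvar(s_α) − n_A(C)` in (2.15) is an even integer number. Thus, `n_A(C) > 0`
if `sgnvar(s_α)` is odd." (The "in particular" clauses — no Cayley structure, or `C` uniform — are
not typed separately.) [cite: BihanDickenstein2017, Prop. 2.12] -/
def BD2017_prop_2_12 : Prop :=
  ∀ (n : ℕ) (w : Fin (n + 2) → Fin n → ℤ) (C : Matrix (Fin n) (Fin (n + 2)) ℝ),
    RankCond w C → PosConeCond C → IsCircuit w →
    ∀ α : Equiv.Perm (Fin (n + 2)), IsOrdering C α →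
    ∀ K : Finset (Fin (n + 2)), IsMaxMinorSet C K →
      (posSolutions w C).Finite →
      ∀ hk : 0 < K.card,
        lambdaBar w C K α ⟨0, hk⟩ ≠ 0 → lambdaBar w C K α ⟨K.card - 1, Nat.sub_lt hk one_pos⟩ ≠ 0 →
          Even ((signVar (sAlpha w C K α) : ℤ) - numPosSols w C) ∧
            (Odd (signVar (sAlpha w C K α)) → (posSolutions w C).Nonempty)

/-- **BD 2017, Prop. 2.13** (p0008:L25 "Proposition 13"): "Let `A, C` of maximal rank. Assume
`n_A(C) > 0` and let `d = (d_0, …, d_{n+1})` be a nonzero vector in `ker(C)`. Let `α` be an ordering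
of `C`. Then `n_A(C)` is finite if and only if there exists `r ∈ [k]` such that `d_{ᾱ_r} · λ̄_r ≠ 0`."
[cite: BihanDickenstein2017, Prop. 2.13] -/
def BD2017_prop_2_13 : Prop :=
  ∀ (n : ℕ) (w : Fin (n + 2) → Fin n → ℤ) (C : Matrix (Fin n) (Fin (n + 2)) ℝ),
    RankCond w C → IsCircuit w → (posSolutions w C).Nonempty →
    ∀ d : Fin (n + 2) → ℝ, d ≠ 0 → C.mulVec d = 0 →
    ∀ α : Equiv.Perm (Fin (n + 2)), IsOrdering C α →
    ∀ K : Finset (Fin (n + 2)), IsMaxMinorSet C K →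
      ((posSolutions w C).Finite ↔
        ∃ r : Fin K.card, d (restrictOrdering α K r) * (lambdaBar w C K α r : ℝ) ≠ 0)

/-! ### §3 Bounds and signature of the circuit -/

/-- **BD 2017, Cor. 3.1** (p0009:L10 "Corollary 14"): "Let `k` be the cardinality of a maximal subset
`K ⊂ [n+2]` with `det(C(i,j)) ≠ 0` for any distinct `i, j ∈ K`. Then `n_A(C) ≤ k − 1`." (Setting of
§3: `A`, `C` as in the Introduction satisfying (1.3), (1.5); `n_A(C)` finite as in (2.15).)
[cite: BihanDickenstein2017, Cor. 3.1] -/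
def BD2017_cor_3_1 : Prop :=
  ∀ (n : ℕ) (w : Fin (n + 2) → Fin n → ℤ) (C : Matrix (Fin n) (Fin (n + 2)) ℝ),
    RankCond w C → PosConeCond C → IsCircuit w →
    ∀ K : Finset (Fin (n + 2)), IsMaxMinorSet C K →
      (posSolutions w C).Finite → numPosSols w C ≤ K.card - 1

/-- **BD 2017, Thm. 3.3** (p0009:L33 "Theorem 16"): "Let `𝒜` and `C` as in the statement of Thm. 2.9 with
`n_A(C) < ∞`. If `𝒜` has signature `{a₊, a₋}`, `n_A(C) ≤ 2σ(𝒜)` if `a₊ ≠ a₋`, and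
`n_A(C) ≤ 2σ(𝒜) − 1` if `a₊ = a₋` (3.2). Moreover, if `n_A(C) = n + 1`, then `C` is uniform and the
support `𝒜` is a circuit with maximal signature `{⌊(n+2)/2⌋, n + 2 − ⌊(n+2)/2⌋}` (3.3)."
[cite: BihanDickenstein2017, Thm. 3.3] -/
def BD2017_thm_3_3 : Prop :=
  ∀ (n : ℕ) (w : Fin (n + 2) → Fin n → ℤ) (C : Matrix (Fin n) (Fin (n + 2)) ℝ),
    RankCond w C → PosConeCond C → IsCircuit w → (posSolutions w C).Finite →
      (numPosSols w C ≤ if sigPos w ≠ sigNeg w then 2 * sigma w else 2 * sigma w - 1) ∧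
      (numPosSols w C = n + 1 →
        IsUniform C ∧ ({sigPos w, sigNeg w} : Finset ℕ) = {(n + 2) / 2, n + 2 - (n + 2) / 2})

/-- **BD 2017, Cor. 3.4** (p0009:L92 "Corollary 17"): "Let `𝒜` and `C` as in the statement of Thm. 2.9
with `n_A(C) < ∞`. If `𝒜` consists of the vertices of a simplex plus one interior point then
`n_𝒜(C) ≤ 2`." (The point `w_ℓ` lies in the interior of the convex hull of the other `n + 1`
points, which are affinely independent.) [cite: BihanDickenstein2017, Cor. 3.4] -/
def BD2017_cor_3_4 : Prop :=
  ∀ (n : ℕ) (w : Fin (n + 2) → Fin n → ℤ) (C : Matrix (Fin n) (Fin (n + 2)) ℝ),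
    RankCond w C → PosConeCond C → IsCircuit w → (posSolutions w C).Finite →
    (∃ ℓ : Fin (n + 2),
      AffineIndependent ℝ (fun j : {j : Fin (n + 2) // j ≠ ℓ} => realPt w j.1) ∧
      realPt w ℓ ∈ interior (convexHull ℝ (Set.range fun j : {j : Fin (n + 2) // j ≠ ℓ} => realPt w j.1))) →
      numPosSols w C ≤ 2

/-! ### §5 Optimality of the bounds -/

/-- **BD 2017, Thm. 5.1** (p0013:L12 "Theorem 22"): "Let `r` and `n` be any integer numbers such that
`0 ≤ r ≤ n` and `n > 0`. (1) There exist matrices `A, C` satisfying (1.3) and (1.5), and an ordering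
`ᾱ : [k] → K` of `C` such that `sgnvar(λ̄_0, …, λ̄_{k−1}) = 1 + r` and `n_A(C) = 1 + r`. (2) For any
positive integers `a₊, a₋` there exist matrices `A, C` satisfying (1.3) and (1.5), such that the set
`𝒜 ⊂ ℝ^n` consisting of the column vectors of `A` except the first row of `1`'s, has signature
`{a₊, a₋}` and `n_A(C) = 2σ(𝒜)` if `a₊ ≠ a₋`, `2σ(𝒜) − 1` if `a₊ = a₋`." (In (2) the dimension is
the one forced by `a₊ + a₋ = n + 2`; typed with `n` existential.) [cite: BihanDickenstein2017, Thm. 5.1] -/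
def BD2017_thm_5_1 : Prop :=
  (∀ r n : ℕ, r ≤ n → 0 < n →
    ∃ (w : Fin (n + 2) → Fin n → ℤ) (C : Matrix (Fin n) (Fin (n + 2)) ℝ)
      (α : Equiv.Perm (Fin (n + 2))) (K : Finset (Fin (n + 2))),
      RankCond w C ∧ PosConeCond C ∧ IsOrdering C α ∧ IsMaxMinorSet C K ∧
        signVar (sAlpha w C K α) = 1 + r ∧ (posSolutions w C).Finite ∧ numPosSols w C = 1 + r) ∧
  (∀ ap am : ℕ, 0 < ap → 0 < am →
    ∃ (n : ℕ) (w : Fin (n + 2) → Fin n → ℤ) (C : Matrix (Fin n) (Fin (n + 2)) ℝ),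
      RankCond w C ∧ PosConeCond C ∧ IsCircuit w ∧
        ({sigPos w, sigNeg w} : Finset ℕ) = {ap, am} ∧ (posSolutions w C).Finite ∧
        numPosSols w C = (if ap ≠ am then 2 * min ap am else 2 * min ap am - 1))

end Facts

end Literature.Computability.AlgebraicComplexity
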